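import Literature.Geometry.Symplectic.OrigamiCutCentre
import Literature.Geometry.Symplectic.OrigamiCollarNormalForm
import Literature.Geometry.Symplectic.OrigamiUnfolding
import Literature.Geometry.Symplectic.OrigamiSidesConnected
import Literature.Geometry.Symplectic.OrigamiFoldNullLine
import Literature.Geometry.Symplectic.CircleConnectionFormCurvature
import HarnessLib

/-!
# Unfolding of an origami 4-manifold from the collar normal form

Proofs companion of `OrigamiUnfolding.lean`: **the named fact
`exists_symplecticCutPieces_of_isOrigamiForm` (Cannas da Silva–Guillemin–Pires, *Symplectic
Origami*, IMRN 2011 = arXiv:0909.4065, Prop. 2.8 with Def. 2.13 and the proof of Prop. 2.26)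
follows from the origami normal form of the fold** `exists_origamiCollarNormalForm`
(Cannas da Silva–Guillemin–Woodward 2000, Thm. 1: a Moser collar `c : Z × (-δ, δ) → 𝒰` with
`c^*ω = p^*i^*ω + d(t² p^*α)`), at universe `0`.

* `exists_cutPiece_of_collar` — for ONE orientation `o`: from fold data `(N, j, θ)`, a connection
  form `α` and a collar `c` in normal form, the setting `D : CutCollarData M N` of
  `OrigamiCutGlueMaps.lean` with side `V = M⁺(o)` (`i^*ω` is basic by
  `isCircleBasicForm_of_horizontal`, its kernel is the orbit line by
  `IsFoldedForm.null_iff_exists_eq_smul`, `dα` is basic by `isCircleBasicForm_mextDeriv`,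
  `closure M⁺ = M⁺ ∪ Z` by `IsFoldedForm.closure_posSide`), whence the cut piece
  `(M₀⁺, ω₀⁺) = (D.Piece, D.pieceForm)` (`OrigamiCutGlue*.lean`, `OrigamiCutPieceForm.lean`),
  its centre `B = N/S¹` (`OrigamiCutCentre.lean`) and the blow-down `D.blowDown`
  (`OrigamiCutBlowDown.lean`) with all the clauses of the fact for that side;
* `exists_symplecticCutPieces_of_normalForm` — the fact: the normal form is applied to `o` and to
  `-o` (`M⁻(o) = M⁺(-o)`), and the two sides are packaged over `Fin 2`.

Everything here is proved; no definitions, no facts.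

## References

* A. Cannas da Silva, V. Guillemin, A. R. Pires, *Symplectic Origami*, IMRN 2011 =
  arXiv:0909.4065, Prop. 2.8, Def. 2.13, proof of Prop. 2.26. [CannasdasilvaGuilleminPires2010]
* A. Cannas da Silva, V. Guillemin, C. Woodward, *On the unfolding of folded symplectic
  structures*, Math. Res. Lett. 7 (2000) 35–53, Thm. 1. [CannasGuilleminWoodward2000]
-/

noncomputable section

open scoped Manifold ContDiff Topology
open Set Function Filter TopologicalSpace
open _root_.Topology
open Literature.Geometry.Kaehler Literature.Geometry.Manifold
open Literature.Topology.FourManifolds (SmoothOrientation)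

namespace Literature.Geometry.Symplectic

/-- `finrank ℝ ℝ² + 1 = 3`. [folklore] -/
private theorem finrank_two_add_one' : Module.finrank ℝ (EuclideanSpace ℝ (Fin 2)) + 1 = 3 := by
  rw [finrank_euclideanSpace_fin]

/-- **One cut piece from a collar in normal form.** For an orientation `o` of the compact connected
4-manifold `M`, an origami form `so` with connected fold, fold data `(N, j, θ)`, a smooth
`θ`-invariant connection form `α` and a collar `c : N × (-δ, δ) → M` in origami normal form with
`c (N × (0, δ)) ⊆ M⁺(o)` and `c (N × (-δ, 0)) ⊆ M⁻(o)`: the cut piece `M₀⁺`, a closed connected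
symplectic 4-manifold, its centre, a compact connected symplectic surface `B = N/S¹ ↪ M₀⁺`, and the
blow-down `M → M₀⁺` with all the properties listed in
`exists_symplecticCutPieces_of_isOrigamiForm` for the side `M⁺(o)`.
[cite: CannasdasilvaGuilleminPires2010, Prop. 2.8 with Def. 2.13 and proof of Prop. 2.26] -/
theorem exists_cutPiece_of_collar
    {M : Type} [TopologicalSpace M] [T2Space M] [SecondCountableTopology M]
    [ChartedSpace (EuclideanSpace ℝ (Fin 4)) M] [IsManifold (𝓡 4) ∞ M] [CompactSpace M]
    [ConnectedSpace M] (o : SmoothOrientation (𝓡 4) M) {so : MForm (𝓡 4) M ℝ 2}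
    (hconn : IsConnected (fold so))
    {N : Type} [TopologicalSpace N] [ChartedSpace (EuclideanSpace ℝ (Fin 3)) N]
    [IsManifold (𝓡 3) ∞ N] [CompactSpace N]
    {j : N → M} {θ : Circle → N → N} {α : MForm (𝓡 3) N ℝ 1} {c : N × ℝ → M} {δ : ℝ}
    (hf : IsFoldedForm so N j)
    (hθ : ContMDiff ((𝓡 1).prod (𝓡 3)) (𝓡 3) ∞ (fun p : Circle × N => θ p.1 p.2))
    (h1 : ∀ n, θ 1 n = n) (hmul : ∀ a b n, θ (a * b) n = θ a (θ b n))
    (hfree : ∀ a n, θ a n = n → a = 1)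
    (htan : ∀ (n : N) (w : TangentSpace (𝓡 4) (j n)),
      so (j n) ![mfderiv 𝓘(ℝ, ℝ) (𝓡 4) (fun t : ℝ => j (θ (Circle.exp t) n)) 0 (1 : ℝ), w] = 0)
    (hαs : IsSmoothForm α)
    (hαi : ∀ (a : Circle) (n : N) (v : Fin 1 → TangentSpace (𝓡 3) n),
      α (θ a n) (fun i => mfderiv (𝓡 3) (𝓡 3) (θ a) n (v i)) = α n v)
    (hαX : ∀ n : N, α n ![mfderiv 𝓘(ℝ, ℝ) (𝓡 3) (fun t : ℝ => θ (Circle.exp t) n) 0 (1 : ℝ)] = 1)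
    (hδ : 0 < δ)
    (hcs : ContMDiffOn ((𝓡 3).prod 𝓘(ℝ, ℝ)) (𝓡 4) ∞ c (univ ×ˢ Ioo (-δ) δ))
    (hc0 : ∀ n, c (n, 0) = j n)
    (hci : InjOn c (univ ×ˢ Ioo (-δ) δ))
    (hcb : ∀ (n : N) (t : ℝ), t ∈ Ioo (-δ) δ →
      Function.Bijective (mfderiv ((𝓡 3).prod 𝓘(ℝ, ℝ)) (𝓡 4) c (n, t)))
    (hsd : ∀ (n : N) (t : ℝ), t ∈ Ioo 0 δ → c (n, t) ∈ posSide o so ∧ c (n, -t) ∈ posSide (-o) so)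
    (hpull : ∀ p ∈ (univ ×ˢ Ioo (-δ) δ : Set (N × ℝ)),
      so.pullback ((𝓡 3).prod 𝓘(ℝ, ℝ)) c p =
        ((so.pullback (𝓡 3) j).pullback ((𝓡 3).prod 𝓘(ℝ, ℝ)) (Prod.fst : N × ℝ → N) +
          mextDeriv ((fun q : N × ℝ => q.2 ^ 2) •
            α.pullback ((𝓡 3).prod 𝓘(ℝ, ℝ)) (Prod.fst : N × ℝ → N))) p) :
    ∃ (N' : Type) (_ : TopologicalSpace N') (_ : T2Space N') (_ : SecondCountableTopology N')
      (_ : CompactSpace N') (_ : ConnectedSpace N') (_ : ChartedSpace (EuclideanSpace ℝ (Fin 4)) N')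
      (_ : IsManifold (𝓡 4) ∞ N') (s : MForm (𝓡 4) N' ℝ 2)
      (S : Type) (_ : TopologicalSpace S) (_ : CompactSpace S) (_ : ConnectedSpace S)
      (_ : ChartedSpace (EuclideanSpace ℝ (Fin 2)) S) (_ : IsManifold (𝓡 2) ∞ S)
      (b : S → N') (β : M → N'),
      IsSmoothForm s ∧ IsClosedForm s ∧
        (∀ x (v : TangentSpace (𝓡 4) x), v ≠ 0 → ∃ w, s x ![v, w] ≠ 0) ∧
        Manifold.IsSmoothEmbedding (𝓡 2) (𝓡 4) ∞ b ∧
        (∀ y (v : TangentSpace (𝓡 2) y), v ≠ 0 → ∃ w : TangentSpace (𝓡 2) y,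
          s (b y) ![mfderiv (𝓡 2) (𝓡 4) b y v, mfderiv (𝓡 2) (𝓡 4) b y w] ≠ 0) ∧
        (∃ U : Set M, IsOpen U ∧ closure (posSide o so) ⊆ U ∧ ContMDiffOn (𝓡 4) (𝓡 4) ∞ β U) ∧
        Set.InjOn β (posSide o so) ∧ β '' posSide o so = (Set.range b)ᶜ ∧
        (∀ x ∈ posSide o so, Function.Bijective (mfderiv (𝓡 4) (𝓡 4) β x)) ∧
        (∀ x ∈ posSide o so, ∀ v w : TangentSpace (𝓡 4) x,
          s (β x) ![mfderiv (𝓡 4) (𝓡 4) β x v, mfderiv (𝓡 4) (𝓡 4) β x w] = so x ![v, w]) ∧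
        β '' fold so = Set.range b ∧
        (∀ x ∈ fold so,
          Module.finrank ℝ (LinearMap.ker (mfderiv (𝓡 4) (𝓡 4) β x).toLinearMap) = 1) := by
  letI : MulAction Circle N := circleMulAction θ h1 hmul
  haveI : T2Space N := hf.embedding.isEmbedding.t2Space
  obtain ⟨z, hz⟩ := hconn.nonempty
  haveI : Nonempty N := by
    rw [← hf.range_eq] at hz
    obtain ⟨n, -⟩ := hz
    exact ⟨n⟩
  haveI : ConnectedSpace N := by
    rw [connectedSpace_iff_univ]
    refine ⟨univ_nonempty, (hf.embedding.isEmbedding.isInducing.isPreconnected_image).1 ?_⟩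
    rw [image_univ, hf.range_eq]
    exact hconn.isPreconnected
  have hθ' : ContMDiff ((𝓡 1).prod (𝓡 3)) (𝓡 3) ∞ (fun x : Circle × N => x.1 • x.2) := hθ
  have hfree' : ∀ (a : Circle) (x : N), a • x = x → a = 1 := hfree
  have hαX' : ∀ n : N, α n ![circleFundVec n] = 1 := hαX
  have hαi' : ∀ (a : Circle) (n : N) (v : Fin 1 → TangentSpace (𝓡 3) n),
      α (a • n) (fun i => mfderiv (𝓡 3) (𝓡 3) (fun y : N => a • y) n (v i)) = α n v := hαi
  -- the restriction of `so` to the fold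
  have hj : ContMDiff (𝓡 3) (𝓡 4) ∞ j := hf.embedding.contMDiff
  have hωZs : IsSmoothForm (so.pullback (𝓡 3) j) :=
    Literature.NumberTheory.Transcendental.isSmoothForm_pullback hj hf.smooth
  have hωZc : IsClosedForm (so.pullback (𝓡 3) j) := by
    have h0 : mextDeriv so = 0 := hf.closed
    show mextDeriv (so.pullback (𝓡 3) j) = 0
    rw [Literature.NumberTheory.Transcendental.mextDeriv_pullback hj hf.smooth, h0, MForm.pullback_zero]
  have hhor : ∀ (n : N) (v : Fin 2 → TangentSpace (𝓡 3) n) (i : Fin 2),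
      v i = circleFundVec n → (so.pullback (𝓡 3) j) n v = 0 := by
    intro n v i hi
    have hv : v = ![v 0, v 1] := by
      funext k; fin_cases k <;> rfl
    rw [hv]
    fin_cases i
    · have hi0 : v 0 = circleFundVec n := hi
      rw [hi0]
      exact hf.null_orbitVelocity hθ h1 htan n (v 1)
    · have hi1 : v 1 = circleFundVec n := hi
      rw [hi1, camTwo_swap' ((so.pullback (𝓡 3) j) n) (circleFundVec n) (v 0), neg_eq_zero]
      exact hf.null_orbitVelocity hθ h1 htan n (v 0)
  have hωZb : IsCircleBasicForm (so.pullback (𝓡 3) j) :=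
    isCircleBasicForm_of_horizontal hθ' hfree' finrank_two_add_one' hωZs hωZc hhor
  have hker : ∀ (n : N) (a : TangentSpace (𝓡 3) n), (∀ b, (so.pullback (𝓡 3) j) n ![a, b] = 0) →
      ∃ r : ℝ, a = r • circleFundVec n :=
    fun n a ha => (hf.null_iff_exists_eq_smul hθ h1 hmul hfree htan n a).1 ha
  have hdα : IsCircleBasicForm (mextDeriv α) :=
    isCircleBasicForm_mextDeriv hθ' hfree' finrank_two_add_one' hαs hαi' hαX'
  -- the fold is the image of the zero section of the collar
  have hZ : c '' (univ ×ˢ {0}) = fold so := by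
    rw [← hf.range_eq]
    ext x
    constructor
    · rintro ⟨⟨n, t⟩, ⟨-, ht⟩, rfl⟩
      rw [mem_singleton_iff] at ht
      subst ht
      exact ⟨n, (hc0 n).symm⟩
    · rintro ⟨n, rfl⟩
      exact ⟨(n, 0), ⟨mem_univ _, rfl⟩, hc0 n⟩
  have hdisj := disjoint_posSide_posSide_neg o so
  have hfz : ∀ x ∈ posSide o so, x ∉ fold so := fun x hx hxf =>
    (Set.eq_empty_iff_forall_notMem.1 (fold_inter_posSide o so) x) ⟨hxf, hx⟩
  -- the data of the construction
  let D : CutCollarData M N :=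
    { s := so
      V := ⟨posSide o so, isOpen_posSide o hf.smooth⟩
      ωZ := so.pullback (𝓡 3) j
      α := α
      c := c
      δ := δ
      δ_pos := hδ
      smooth_s := hf.smooth
      closed_s := hf.closed
      smooth_act := hθ'
      free_act := hfree'
      basic_ωZ := hωZb
      smooth_ωZ := hωZs
      closed_ωZ := hωZc
      smooth_α := hαs
      inv_α := hαi'
      α_X := hαX'
      basic_dα := hdα
      ker_ωZ := hker
      smooth_c := hcs
      injOn_c := hci
      bij_c := hcb
      c_mem := fun n t ht => (hsd n t ht).1
      c_not_mem := by
        intro n t ht hV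
        rcases ht.2.lt_or_eq with hlt | heq
        · have hm : c (n, t) ∈ posSide (-o) so := by
            have h := (hsd n (-t) ⟨by linarith, by linarith [ht.1]⟩).2
            rwa [neg_neg] at h
          exact Set.disjoint_left.1 hdisj hV hm
        · subst heq
          exact hfz _ hV (hZ ▸ ⟨(n, 0), ⟨mem_univ _, rfl⟩, rfl⟩)
      closure_subset := by
        show closure (posSide o so) ⊆ posSide o so ∪ c '' (univ ×ˢ {0})
        rw [hf.closure_posSide o, hZ]
      pullback_c := hpull
      nondeg := fun x hx v hv => forall_ne_zero_of_not_mem_fold (hfz x hx) hv }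
  have hZ' : D.c '' (univ ×ˢ {0}) = fold so := hZ
  haveI := D.t2Space_piece
  haveI := D.secondCountableTopology_piece
  haveI := D.compactSpace_piece
  haveI := D.connectedSpace_piece (hf.isConnected_posSide hconn o)
  letI := D.csQ
  haveI := D.isManifold_Q
  refine ⟨D.Piece, inferInstance, inferInstance, inferInstance, inferInstance, inferInstance,
    inferInstance, inferInstance, D.pieceForm, CircleQuotient N, inferInstance, inferInstance,
    inferInstance, D.csQ, D.isManifold_Q, D.centre, D.blowDown, D.isSmoothForm_pieceForm,
    D.isClosedForm_pieceForm, D.pieceForm_nondegenerate, D.isSmoothEmbedding_centre,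
    D.pieceForm_centre_nondegenerate, D.exists_nbhd_contMDiffOn_blowDown, D.injOn_blowDown,
    D.image_blowDown_V, fun x hx => D.bijective_mfderiv_blowDown hx, fun x hx v w => ?_, ?_,
    fun x hx => D.finrank_ker_mfderiv_blowDown_of_mem (hZ'.symm ▸ hx)⟩
  · have hvec : (![mfderiv (𝓡 4) (𝓡 4) D.blowDown x v, mfderiv (𝓡 4) (𝓡 4) D.blowDown x w] :
        Fin 2 → TangentSpace (𝓡 4) (D.blowDown x)) =
        fun i => mfderiv (𝓡 4) (𝓡 4) D.blowDown x (![v, w] i) := by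
      funext i; fin_cases i <;> rfl
    rw [hvec]
    exact D.pieceForm_blowDown_apply hx ![v, w]
  · rw [← hZ']
    exact D.image_blowDown_zero

/-- **One cut piece from the normal form**, for an orientation `o`: `exists_cutPiece_of_collar`
applied to the data of `exists_origamiCollarNormalForm` at `o`.
[cite: CannasdasilvaGuilleminPires2010, Prop. 2.8 with Def. 2.13 and proof of Prop. 2.26] -/
theorem exists_cutPiece_of_normalForm (h : exists_origamiCollarNormalForm.{0})
    {M : Type} [TopologicalSpace M] [T2Space M] [SecondCountableTopology M]
    [ChartedSpace (EuclideanSpace ℝ (Fin 4)) M] [IsManifold (𝓡 4) ∞ M] [CompactSpace M]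
    [ConnectedSpace M] (o : SmoothOrientation (𝓡 4) M) {so : MForm (𝓡 4) M ℝ 2}
    (hs : IsOrigamiForm so) (hconn : IsConnected (fold so)) :
    ∃ (N' : Type) (_ : TopologicalSpace N') (_ : T2Space N') (_ : SecondCountableTopology N')
      (_ : CompactSpace N') (_ : ConnectedSpace N') (_ : ChartedSpace (EuclideanSpace ℝ (Fin 4)) N')
      (_ : IsManifold (𝓡 4) ∞ N') (s : MForm (𝓡 4) N' ℝ 2)
      (S : Type) (_ : TopologicalSpace S) (_ : CompactSpace S) (_ : ConnectedSpace S)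
      (_ : ChartedSpace (EuclideanSpace ℝ (Fin 2)) S) (_ : IsManifold (𝓡 2) ∞ S)
      (b : S → N') (β : M → N'),
      IsSmoothForm s ∧ IsClosedForm s ∧
        (∀ x (v : TangentSpace (𝓡 4) x), v ≠ 0 → ∃ w, s x ![v, w] ≠ 0) ∧
        Manifold.IsSmoothEmbedding (𝓡 2) (𝓡 4) ∞ b ∧
        (∀ y (v : TangentSpace (𝓡 2) y), v ≠ 0 → ∃ w : TangentSpace (𝓡 2) y,
          s (b y) ![mfderiv (𝓡 2) (𝓡 4) b y v, mfderiv (𝓡 2) (𝓡 4) b y w] ≠ 0) ∧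
        (∃ U : Set M, IsOpen U ∧ closure (posSide o so) ⊆ U ∧ ContMDiffOn (𝓡 4) (𝓡 4) ∞ β U) ∧
        Set.InjOn β (posSide o so) ∧ β '' posSide o so = (Set.range b)ᶜ ∧
        (∀ x ∈ posSide o so, Function.Bijective (mfderiv (𝓡 4) (𝓡 4) β x)) ∧
        (∀ x ∈ posSide o so, ∀ v w : TangentSpace (𝓡 4) x,
          s (β x) ![mfderiv (𝓡 4) (𝓡 4) β x v, mfderiv (𝓡 4) (𝓡 4) β x w] = so x ![v, w]) ∧
        β '' fold so = Set.range b ∧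
        (∀ x ∈ fold so,
          Module.finrank ℝ (LinearMap.ker (mfderiv (𝓡 4) (𝓡 4) β x).toLinearMap) = 1) := by
  obtain ⟨N, _, _, _, _, j, θ, α, c, δ, hf, hθ, h1, hmul, hfree, htan, hαs, hαi, hαX, hδ, hcs,
    hc0, hci, -, hcb, hsd, hpull⟩ := h M o so hs
  exact exists_cutPiece_of_collar o hconn hf hθ h1 hmul hfree htan hαs hαi hαX hδ hcs hc0
    hci hcb hsd hpull

/-- **The unfolding of a compact oriented origami 4-manifold with connected fold follows from the
origami normal form of the fold** (universe `0`): `exists_origamiCollarNormalForm` (Cannas da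
Silva–Guillemin–Woodward 2000, Thm. 1) implies `exists_symplecticCutPieces_of_isOrigamiForm`
(Cannas da Silva–Guillemin–Pires 2010, Prop. 2.8 with Def. 2.13, proof of Prop. 2.26): the normal
form is applied to the orientations `o` and `-o`, giving the two cut pieces `M₀⁺`, `M₀⁻` over the
sides `M⁺(o)`, `M⁻(o) = M⁺(-o)`.
[cite: CannasdasilvaGuilleminPires2010, Prop. 2.8 with Def. 2.13 and proof of Prop. 2.26] -/
theorem exists_symplecticCutPieces_of_normalForm (h : exists_origamiCollarNormalForm.{0}) :
    exists_symplecticCutPieces_of_isOrigamiForm.{0} := by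
  intro M _ _ _ _ _ _ _ hor so hs hconn
  obtain ⟨o⟩ := hor
  set os : Fin 2 → SmoothOrientation (𝓡 4) M := ![o, -o] with hos
  have hside := fun i : Fin 2 => exists_cutPiece_of_normalForm h (os i) hs hconn
  choose N tN t2N scN cN coN chN mN s S tS cS coS chS mS b β hP using hside
  refine ⟨fun i => ⟨posSide (os i) so, isOpen_posSide (os i) hs.isSmoothForm⟩, N, tN, t2N, scN, cN,
    coN, chN, mN, s, S, tS, cS, coS, chS, mS, b, β, ⟨?_, ?_, ?_⟩, hP⟩
  · rw [← TopologicalSpace.Opens.coe_disjoint]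
    exact disjoint_posSide_posSide_neg o so
  · obtain ⟨N₀, _, _, _, _, j₀, hf₀⟩ := hs.exists_isFoldedForm
    obtain ⟨z, hz⟩ := hconn.nonempty
    intro i
    exact hf₀.posSide_nonempty (os i) hz
  · change (posSide o so ∪ posSide (-o) so)ᶜ = fold so
    rw [posSide_union_posSide_neg, compl_compl]

end Literature.Geometry.Symplectic

end
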